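import Summits.Parity.GeneralizedHardyLittlewood.Theorems.GreenTaoLevelTwoGITwoCyclicInverseTrilinear

/-!
# Route `GreenTaoLevelTwo`, crux `GITwo` (stmt-Parity-21275), line `birth`, stub `stub_cyclicInverse`:
# GT08a §9 Step 4 — the `fgh`-lemma applied inside the `y`-family

Fifty-fifth helper file toward the XL stub `stub_cyclicInverse` (B. Green, T. Tao, *An inverse
theorem for the Gowers `U³(G)` norm*, arXiv:math/0503014, Thm. 68 = PEMS 51 (2008) Thm. 12.8).
Block C13, §9 Step 4 ("Let us now apply Lemma (fgh-bohr) …"): for each `y`, the localised double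
sum `Σ_{h∈B} b₁(y,h) Σ_{w∈B'} f(y,w) b₂(y,w+h)` (output shape of `exists_localised_family`) is a
trilinear form, so arXiv Lemma 23 (`norm_trilinear_sq_le`, `…Trilinear`) produces a frequency
`ξ_y` with `|Σ_{w∈B'} f(y,w) e(wξ_y/N)|` at least `|T_y| / (#B · #(B'+B))^{1/2}`; summing over `y`:

* `exists_freq_family` — `∃ ξ : ℤ/Nℤ → ℤ/Nℤ` with
  `Σ_y |Σ_{h∈B} b₁(y,h) Σ_{w∈B'} f(y,w) b₂(y,w+h)| ≤ √(#B #(B'+B)) · Σ_y |Σ_{w∈B'} f(y,w) e(wξ_y/N)|`.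

References: [GreenTao2008U3Inverse] arXiv:math/0503014, §9 Step 4, Lemma 23.
-/

noncomputable section

namespace Summit.Parity.GeneralizedHardyLittlewood.GreenTaoLevelTwoGITwoCyclicInverse

open Finset ZMod
open scoped Pointwise

variable {N : ℕ} [NeZero N]

/-- **GT08a §9 Step 4: the `fgh`-lemma inside the family.**  For finsets `B, B' ⊆ ℤ/Nℤ` and families
`f, b₂ : ℤ/Nℤ → ℤ/Nℤ → ℂ`, `b₁ : ℤ/Nℤ → ℤ/Nℤ → ℂ` with `‖b₁ y h‖ ≤ 1` on `B` and `‖b₂ y v‖ ≤ 1`,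
there is `ξ : ℤ/Nℤ → ℤ/Nℤ` with
`Σ_y |Σ_{h∈B} b₁(y,h) Σ_{w∈B'} f(y,w) b₂(y,w+h)| ≤ √(#B · #(B'+B)) · Σ_y |Σ_{w∈B'} f(y,w) e(wξ_y/N)|`.
[cite: GreenTao2008U3Inverse, §9 Step 4 (via Lemma 23)] -/
theorem exists_freq_family (B B' : Finset (ZMod N)) (f b₂ : ZMod N → ZMod N → ℂ)
    (b₁ : ZMod N → ZMod N → ℂ) (hb₁ : ∀ y, ∀ h ∈ B, ‖b₁ y h‖ ≤ 1) (hb₂ : ∀ y v, ‖b₂ y v‖ ≤ 1) :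
    ∃ ξ : ZMod N → ZMod N,
      ∑ y : ZMod N, ‖∑ h ∈ B, b₁ y h * ∑ w ∈ B', f y w * b₂ y (w + h)‖ ≤
        Real.sqrt ((#B : ℝ) * #(B' + B)) * ∑ y : ZMod N, ‖∑ w ∈ B', f y w * stdAddChar (w * ξ y)‖ := by
  classical
  -- per `y`, Lemma 23
  have hy : ∀ y : ZMod N, ∃ ξ₀ : ZMod N,
      ‖∑ h ∈ B, b₁ y h * ∑ w ∈ B', f y w * b₂ y (w + h)‖ ≤
        Real.sqrt ((#B : ℝ) * #(B' + B)) * ‖∑ w ∈ B', f y w * stdAddChar (w * ξ₀)‖ := by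
    intro y
    obtain ⟨ξ₀, hξ₀⟩ := norm_trilinear_sq_le B B' (f y) (b₁ y) (b₂ y) (hb₁ y) (hb₂ y)
    refine ⟨ξ₀, ?_⟩
    -- rewrite the double sum in the trilinear order
    have hT : ∑ h ∈ B, b₁ y h * ∑ w ∈ B', f y w * b₂ y (w + h) =
        ∑ w ∈ B', ∑ h ∈ B, f y w * b₁ y h * b₂ y (w + h) := by
      rw [Finset.sum_comm]
      refine sum_congr rfl fun h _ => ?_
      rw [mul_sum]
      exact sum_congr rfl fun w _ => by ring
    rw [hT]
    -- `a² ≤ c b²` ⇒ `a ≤ √c · b` (cf. `Literature.Analysis.Hypoelliptic.le_sqrt_mul_of_sq_le`)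
    have hc : (0 : ℝ) ≤ (#B : ℝ) * #(B' + B) := by positivity
    have h1 : ‖∑ w ∈ B', ∑ h ∈ B, f y w * b₁ y h * b₂ y (w + h)‖ ^ 2 ≤
        (Real.sqrt ((#B : ℝ) * #(B' + B)) * ‖∑ w ∈ B', f y w * stdAddChar (w * ξ₀)‖) ^ 2 := by
      rw [mul_pow, Real.sq_sqrt hc]
      calc ‖∑ w ∈ B', ∑ h ∈ B, f y w * b₁ y h * b₂ y (w + h)‖ ^ 2
          ≤ #B * #(B' + B) * ‖∑ w ∈ B', f y w * stdAddChar (w * ξ₀)‖ ^ 2 := hξ₀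
        _ = (#B : ℝ) * #(B' + B) * ‖∑ w ∈ B', f y w * stdAddChar (w * ξ₀)‖ ^ 2 := by ring
    exact (pow_le_pow_iff_left₀ (norm_nonneg _)
      (mul_nonneg (Real.sqrt_nonneg _) (norm_nonneg _)) two_ne_zero).mp h1
  choose ξ hξ using hy
  refine ⟨ξ, ?_⟩
  rw [mul_sum]
  exact sum_le_sum fun y _ => hξ y

end Summit.Parity.GeneralizedHardyLittlewood.GreenTaoLevelTwoGITwoCyclicInverse
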